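import Summits.CriticalPhenomena.PercolationContinuityZ3.Theorems.PercThresholdOneFragileWeavingGiantExistsExit

/-!
# `FragileWeavingGiantExists` (stmt-CriticalPhenomena-5266) — ancestral chains and connectivity

Part of the proof of support item `FragileWeavingGiantExists` of route `PercThresholdOne` by the stationary
hierarchical spanning tree of `ℤ³` (see `PercThresholdOneFragileWeavingGiantExistsDefs.lean` for the construction and the overview).
-/

noncomputable section

namespace Summit.CriticalPhenomena.PercolationContinuityZ3.Theorems.FragileGiant

open MeasureTheory
open scoped ENNReal
open Literature.Probability.Percolation Literature.Probability.LatticeModels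
open Literature.Probability.Percolation.DCT16

/-- The potential drops at the jump level under a parent step. -/
theorem pot_par_lt (ω : Ω) (hω : ω ∈ goodSet) (u : V3) : pot ω (par ω u) (jlev ω u) < pot ω u (jlev ω u) := by
  unfold pot
  rw [(par_spec ω hω u).2.1, exitType_par_of_lt ω hω u (Nat.lt_succ_self _)]
  exact qdist_qnext_lt _ _ (digit_jlev_ne ω hω u)

/-- The potential is unchanged above the jump level. -/
theorem pot_par_eq (ω : Ω) (hω : ω ∈ goodSet) (u : V3) {m : ℕ} (hm : jlev ω u < m) :
    pot ω (par ω u) m = pot ω u m := by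
  unfold pot
  rw [digit_par_of_lt ω hω u hm, exitType_par_of_lt ω hω u (by omega)]

/-- **No cycles**: no point is its own proper ancestor. -/
theorem iterate_par_ne (ω : Ω) (hω : ω ∈ goodSet) (u : V3) {k : ℕ} (hk : 1 ≤ k) : (par ω)^[k] u ≠ u := by
  intro hcyc
  set g : ℕ → V3 := fun t => (par ω)^[t] u with hg
  have hg_succ : ∀ t, g (t + 1) = par ω (g t) := fun t => by
    simp only [hg, Function.iterate_succ_apply']
  set M := (Finset.range k).sup fun t => jlev ω (g t) with hM
  have hle : ∀ t < k, jlev ω (g t) ≤ M := fun t ht =>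
    Finset.le_sup (f := fun t => jlev ω (g t)) (Finset.mem_range.2 ht)
  obtain ⟨t₀, ht₀k, ht₀⟩ : ∃ t₀ < k, jlev ω (g t₀) = M := by
    obtain ⟨t₀, h1, h2⟩ := Finset.exists_mem_eq_sup (Finset.range k) (by simp; omega) fun t => jlev ω (g t)
    exact ⟨t₀, Finset.mem_range.1 h1, h2.symm⟩
  -- the potential at level `M` is non-increasing along the cycle and drops at `t₀`
  have hstep : ∀ t < k, pot ω (g (t + 1)) M ≤ pot ω (g t) M ∧ (jlev ω (g t) = M → pot ω (g (t + 1)) M < pot ω (g t) M) := by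
    intro t ht
    rw [hg_succ]
    rcases (hle t ht).lt_or_eq with hlt | heq
    · refine ⟨(pot_par_eq ω hω _ hlt).le, fun h => absurd h hlt.ne⟩
    · refine ⟨?_, fun _ => ?_⟩ <;> rw [← heq]
      · exact (pot_par_lt ω hω _).le
      · exact pot_par_lt ω hω _
  have hmono : ∀ t ≤ k, pot ω (g t) M ≤ pot ω (g 0) M ∧ (t₀ < t → pot ω (g t) M < pot ω (g 0) M) := by
    intro t ht
    induction t with
    | zero => exact ⟨le_rfl, fun h => absurd h (Nat.not_lt_zero _)⟩
    | succ t ih =>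
      obtain ⟨ih1, ih2⟩ := ih (Nat.le_of_succ_le ht)
      obtain ⟨hs1, hs2⟩ := hstep t ht
      refine ⟨hs1.trans ih1, fun h => ?_⟩
      rcases Nat.lt_succ_iff_lt_or_eq.1 h with h' | h'
      · exact lt_of_le_of_lt hs1 (ih2 h')
      · exact lt_of_lt_of_le (hs2 (h' ▸ ht₀)) ih1
  have hk' := (hmono k le_rfl).2 ht₀k
  have : g k = g 0 := by simp only [hg, Function.iterate_zero, id_eq]; exact hcyc
  rw [this] at hk'
  exact lt_irrefl _ hk'

/-- **The ancestral chain is injective.** -/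
theorem iterate_par_injective (ω : Ω) (hω : ω ∈ goodSet) (u : V3) :
    Function.Injective fun t : ℕ => (par ω)^[t] u := by
  intro s t h
  simp only at h
  by_contra hne
  wlog hst : s < t generalizing s t
  · exact this h.symm (Ne.symm hne) (lt_of_le_of_ne (not_lt.1 hst) (Ne.symm hne))
  have : (par ω)^[t - s] ((par ω)^[s] u) = (par ω)^[s] u := by
    rw [← Function.iterate_add_apply, Nat.sub_add_cancel hst.le]; exact h.symm
  exact iterate_par_ne ω hω _ (by omega) this

/-- The chain leaves every block. -/
theorem exists_iterate_par_not_mem_blk (ω : Ω) (hω : ω ∈ goodSet) (x : V3) (n : ℕ) :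
    ∃ t, (par ω)^[t] x ∉ blk ω n x := by
  by_contra h
  push Not at h
  have hfin : (Set.range fun t : ℕ => (par ω)^[t] x).Finite :=
    (blk ω n x).finite_toSet.subset (by rintro _ ⟨t, rfl⟩; exact h t)
  exact (Set.infinite_range_of_injective (iterate_par_injective ω hω x)) hfin

/-- If the parent of a point of `B_n` leaves `B_n`, the point is an exit corner of level `≥ n`. -/
theorem le_jlev_of_par_not_mem (ω : Ω) (hω : ω ∈ goodSet) {n : ℕ} {u : V3} (h : par ω u ∉ blk ω n u) :
    n ≤ jlev ω u := by
  by_contra hlt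
  push Not at hlt
  exact h (par_mem_blk_of_lt ω hω u hlt)

/-- The exit vertex depends only on the block. -/
theorem exitVertex_eq_of_mem_blk (ω : Ω) {n : ℕ} {x y : V3} (h : y ∈ blk ω n x) :
    exitVertex ω n y = exitVertex ω n x := by
  funext i
  simp only [exitVertex, sub_rel_eq_of_mem_blk ω h i, exitType_eq_of_mem_blk ω h le_rfl]

/-- A point of `B_n(x)` whose jump level is `≥ n` is the exit vertex of `B_n(x)`. -/
theorem eq_exitVertex_of_le_jlev (ω : Ω) (hω : ω ∈ goodSet) {n : ℕ} {x u : V3} (hu : u ∈ blk ω n x)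
    (hn : n ≤ jlev ω u) : u = exitVertex ω n x := by
  rw [← exitVertex_eq_of_mem_blk ω hu]
  funext i
  simp only [exitVertex]
  rw [rel_of_le_jlev ω hω u hn i, ← exitType_eq_of_le_jlev ω hω u hn]
  ring

/-- **The chain of `x` passes through the exit vertex of every block of `x`**, staying inside the block
before. -/
theorem exists_iterate_eq_exitVertex (ω : Ω) (hω : ω ∈ goodSet) (x : V3) (n : ℕ) :
    ∃ t, (par ω)^[t] x = exitVertex ω n x ∧ (∀ s ≤ t, (par ω)^[s] x ∈ blk ω n x) ∧
      (par ω)^[t + 1] x ∉ blk ω n x := by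
  classical
  have hex := exists_iterate_par_not_mem_blk ω hω x n
  have hT0 : Nat.find hex ≠ 0 := by
    intro h0
    have := Nat.find_spec hex
    rw [h0] at this
    exact this (mem_blk_self ω n x)
  obtain ⟨t, ht⟩ : ∃ t, Nat.find hex = t + 1 := ⟨Nat.find hex - 1, by omega⟩
  have hin : ∀ s ≤ t, (par ω)^[s] x ∈ blk ω n x := fun s hs => by
    have := Nat.find_min hex (show s < Nat.find hex by omega)
    push Not at this
    exact this
  have hout : (par ω)^[t + 1] x ∉ blk ω n x := ht ▸ Nat.find_spec hex
  refine ⟨t, ?_, hin, hout⟩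
  have hu := hin t le_rfl
  apply eq_exitVertex_of_le_jlev ω hω hu
  apply le_jlev_of_par_not_mem ω hω
  rw [blk_eq_of_mem ω hu, ← Function.iterate_succ_apply' (par ω)]
  exact hout

/-- **Chains of two points of a common block meet.** -/
theorem exists_iterate_eq_of_mem_blk (ω : Ω) (hω : ω ∈ goodSet) {n : ℕ} {x y : V3} (h : y ∈ blk ω n x) :
    ∃ s t, (par ω)^[s] y = (par ω)^[t] x := by
  obtain ⟨s, hs, -⟩ := exists_iterate_eq_exitVertex ω hω y n
  obtain ⟨t, ht, -⟩ := exists_iterate_eq_exitVertex ω hω x n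
  exact ⟨s, t, by rw [hs, ht, exitVertex_eq_of_mem_blk ω h]⟩

/-- Neighbours share a block (on the good event). -/
theorem exists_mem_blk_of_adj (ω : Ω) (hω : ω ∈ goodSet) {x y : V3} (hxy : (zdGraph 3).Adj x y) :
    ∃ n, y ∈ blk ω n x := by
  rw [zdGraph_adj_iff] at hxy
  obtain ⟨i, hxy⟩ := hxy
  -- a level with a digit of `x` equal to `1` in coordinate `i`
  obtain ⟨m, -, hm⟩ := hω x center 0
  have hd : digit ω x m i = 1 := by rw [hm]; rfl
  have hlo : 3 ^ m ≤ rel ω (m + 1) x i :=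
    pow_le_rel_of_digit_ne_zero ω (Nat.lt_succ_self m) x i (by rw [hd]; decide)
  have hhi : rel ω (m + 1) x i + 3 ^ m ≤ 3 ^ (m + 1) - 1 :=
    rel_add_pow_le_of_digit_ne_two ω (Nat.lt_succ_self m) x i (by rw [hd]; decide)
  refine ⟨m + 1, ?_⟩
  rcases hxy with rfl | rfl
  · exact (add_single_mem_blk ω (by linarith [three_pow_pos m])).1
  · have h1 : 1 ≤ rel ω (m + 1) (y + Pi.single i 1) i := by linarith [three_pow_pos m]
    have := (sub_single_mem_blk ω h1).1
    rwa [add_sub_cancel_right] at this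

/-- **Any two points share a block** (on the good event). -/
theorem exists_mem_blk (ω : Ω) (hω : ω ∈ goodSet) (x y : V3) : ∃ n, y ∈ blk ω n x := by
  obtain ⟨w⟩ := zdGraph_reachable x y
  induction w with
  | nil => exact ⟨0, mem_blk_self ω 0 _⟩
  | @cons a b c hab _ ih =>
    obtain ⟨n, hn⟩ := ih
    obtain ⟨m, hm⟩ := exists_mem_blk_of_adj ω hω hab
    refine ⟨max n m, ?_⟩
    exact mem_blk_trans ω (blk_mono ω (le_max_right n m) a hm) (blk_mono ω (le_max_left n m) b hn)

/-- Along the chain each coordinate moves by at most one per step. -/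
theorem abs_iterate_par_sub_le (ω : Ω) (u : V3) (i : Fin 3) (t : ℕ) :
    |((par ω)^[t] u) i - u i| ≤ t := by
  induction t with
  | zero => simp
  | succ t ih =>
    have hstep : |par ω ((par ω)^[t] u) i - ((par ω)^[t] u) i| ≤ 1 := by
      set v := (par ω)^[t] u
      simp only [par, Pi.add_apply, add_sub_cancel_left, unitVec]
      split_ifs <;> rcases eq_or_ne i (parDir ω v).1 with h | h
      · subst h; simp
      · simp [Pi.single_eq_of_ne h]
      · subst h; simp
      · simp [Pi.single_eq_of_ne h]
    calc |((par ω)^[t+1] u) i - u i|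
        = |(par ω ((par ω)^[t] u) i - ((par ω)^[t] u) i) + (((par ω)^[t] u) i - u i)| := by
          rw [Function.iterate_succ_apply']; ring_nf
      _ ≤ |par ω ((par ω)^[t] u) i - ((par ω)^[t] u) i| + |((par ω)^[t] u) i - u i| := abs_add_le _ _
      _ ≤ 1 + t := add_le_add hstep ih
      _ = (t + 1 : ℕ) := by push_cast; ring

/-- Membership of an edge in the tree configuration. -/
theorem mem_treeConfig_iff (ω : Ω) (e : Sym2 V3) : e ∈ treeConfig ω ↔ ∃ x, s(x, par ω x) = e := by
  simp [treeConfig]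

/-- The tree configuration is supported on lattice edges. -/
theorem treeConfig_subset_edgeSet (ω : Ω) : treeConfig ω ⊆ (zdGraph 3).edgeSet := by
  rintro e ⟨x, rfl⟩; exact mk_par_mem_edgeSet ω x

/-- A point is joined to its parent in the open graph of the tree. -/
theorem openGraph_treeConfig_adj_par (ω : Ω) (u : V3) : (openGraph (treeConfig ω)).Adj u (par ω u) :=
  (openGraph_adj _ _ _).2 ⟨⟨u, rfl⟩, (par_ne ω u).symm⟩

/-- A point is joined to all its ancestors. -/
theorem reachable_iterate_par (ω : Ω) (u : V3) (t : ℕ) :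
    (openGraph (treeConfig ω)).Reachable u ((par ω)^[t] u) := by
  induction t with
  | zero => exact SimpleGraph.Reachable.refl _
  | succ t ih =>
    rw [Function.iterate_succ_apply']
    exact ih.trans (openGraph_treeConfig_adj_par ω _).reachable

/-- **The tree is connected** (on the good event). -/
theorem reachable_treeConfig (ω : Ω) (hω : ω ∈ goodSet) (x y : V3) :
    (openGraph (treeConfig ω)).Reachable x y := by
  obtain ⟨n, hn⟩ := exists_mem_blk ω hω x y
  obtain ⟨s, t, hst⟩ := exists_iterate_eq_of_mem_blk ω hω hn
  exact (reachable_iterate_par ω x t).trans (hst ▸ (reachable_iterate_par ω y s).symm)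

end Summit.CriticalPhenomena.PercolationContinuityZ3.Theorems.FragileGiant
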